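import Summits.BirchSwinnertonDyer.BirchSwinnertonDyer.Theorems.CyclotomicUntwistWildThreeSplitCubeDiscriminant
import HarnessLib

/-!
# A CUBE-CLASS CRITERION for a unique stable line at `3`: for every elliptic, globally minimal `W/ℚ`,
# if `W[3]|G_{ℚ₃}` is irreducible OR split then `3 ∣ v₃(Δ_min)` and `Δ_min/3^{v₃Δ_min} ≡ ±1 (mod 9)`;
# hence `Δ_min ∉ (ℚ₃ˣ)³ ⟹ Ψ₃` has EXACTLY ONE root in `ℚ₃`

Cell `pub/bsd-wall` (D-0145 line `route-BirchSwinnertonDyer-CyclotomicUntwist`), seat `bsd-line-cycu-p2`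
(prover seat 2/3, gen 4); helper toward K1/K2 (stmt-BirchSwinnertonDyer-21580 / 21581) and the O6 lane
(V10 shapes of `W[3]|G_{ℚ₃}`). THEOREMS ONLY (no definition, no named fact, no `sorry`); BSD is not proved by
this file and no crux is.

## What
* §1 (integers) `cube_class_of_c_relation`: `1728Δ = c₄³ − c₆²`, `c₄ ≠ 0` and the E89 inequality
  `c₆ = 0 ∨ 3v₃(c₄) + 2 ≤ 2v₃(c₆)` force `v₃(Δ) = 3v₃(c₄) − 3` and `Δ/3^{v₃Δ} ≡ c₄′³ ≡ ±1 (mod 9)`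
  (`c₄′ = c₄/3^{v₃c₄}`; `64 ≡ 1 (mod 9)`).
* §2 (curves) `three_dvd_and_mod_nine_of_locIrr` (harvest-2 E89 `locIrr_three_iff_locIrrCriterionThree` + §1),
  `…_of_shapeIrrThree`; with the seat's SPLIT theorem `three_dvd_and_mod_nine_of_shapeSplitThree`
  (`…WildThreeSplitCubeDiscriminant.lean`): **`three_dvd_and_mod_nine_of_not_existsUnique`** — no unique
  stable line ⟹ `Δ_min` is in the CUBE CLASS (`3 ∣ v`, unit part `±1 mod 9`) — and its contrapositive
  **`existsUnique_stableLine_of_not_cubeClass`** / `numStableLinesAtThree_eq_one_of_not_cubeClass`: for EVERY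
  elliptic globally minimal `W/ℚ` whose minimal discriminant is not a `3`-adic cube (e.g. `3 ∤ v₃Δ_min`), `Ψ₃`
  has exactly one `ℚ₃`-root, i.e. `W[3]|G_{ℚ₃}` is reducible non-split with one stable line.
Census (EVIDENCE, not used; seat folder `census/cube_law_check.py`): on all 64 687 curves with `N < 10⁴` the
criterion is an EQUIVALENCE (`#roots ≠ 1 ⟺ Δ_min ∈ (ℚ₃ˣ)³`, 0 exceptions); the converse is local Galois
theory (`∛Δ ∈ ℚ₃(E[3])`, image a `2`-group) and is not claimed here.
References: J.-P. Serre, Invent. Math. 15 (1972) §5.3 [Serre1972]; J. E. Cremona, *Algorithms* (1997) §3.8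
[Cremona1997]; J.-P. Serre, *Cours d'arithmétique* II §3.3 [Serre1973].
-/

set_option autoImplicit false
-- single-conjunct summit: `Summit.BirchSwinnertonDyer.BirchSwinnertonDyer.…` repeats the name by design
set_option linter.dupNamespace false

noncomputable section

open scoped Classical

open Polynomial WeierstrassCurve Literature.NumberTheory.EllipticCurves
  Literature.NumberTheory.EllipticCurves.Rank1Residual
  Summit.BirchSwinnertonDyer.Rank1Residual.Additive Summit.BirchSwinnertonDyer.Rank1Residual.O5

namespace Summit.BirchSwinnertonDyer.BirchSwinnertonDyer.Theorems.PSLocalThreeTorsion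

/-! ## §1 Integers: the cube class of `Δ` under the E89 inequality -/

section Integers

/-- `v₃(n) = k` from `3ᵏ ∣ n` and `3ᵏ⁺¹ ∤ n`. [folklore] -/
theorem padicValInt_three_eq_of_dvd_of_not_dvd {n : ℤ} {k : ℕ} (h1 : (3 : ℤ) ^ k ∣ n)
    (h2 : ¬ (3 : ℤ) ^ (k + 1) ∣ n) : padicValInt 3 n = k := by
  have hn : n ≠ 0 := by rintro rfl; exact h2 (dvd_zero _)
  have hle : k ≤ padicValInt 3 n := by
    rcases (padicValInt_dvd_iff k n).mp (by exact_mod_cast h1) with h | h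
    · exact absurd h hn
    · exact h
  have hlt : ¬ k + 1 ≤ padicValInt 3 n := by
    intro h
    apply h2
    have := padicValInt_dvd (p := 3) n
    exact_mod_cast (pow_dvd_pow (3 : ℤ) h).trans (by exact_mod_cast this)
  omega

/-- Unit cubes in `ℤ/9` are `±1`. [folklore] -/
theorem zmod_nine_cube_of_unit (x : ZMod 9) (hx : x ^ 3 ≠ 0) : x ^ 3 = 1 ∨ x ^ 3 = 8 := by
  revert x; decide

/-- **The cube class of `Δ` under the E89 inequality.** For integers with `1728Δ = c₄³ − c₆²`,
`c₄ ≠ 0` and `c₆ = 0 ∨ 3·v₃(c₄) + 2 ≤ 2·v₃(c₆)`: `v₃(Δ) + 3 = 3·v₃(c₄)` and `Δ/3^{v₃Δ} ≡ ±1 (mod 9)`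
(`64·Δ/3^{v₃Δ} = c₄′³ − 9m` with `c₄′` the `3`-free part of `c₄`). [cite: Cremona1997, §3.8] -/
theorem cube_class_of_c_relation {c₄ c₆ Δ : ℤ} (h4 : c₄ ≠ 0)
    (hrel : 1728 * Δ = c₄ ^ 3 - c₆ ^ 2)
    (hcrit : c₆ = 0 ∨ 3 * padicValInt 3 c₄ + 2 ≤ 2 * padicValInt 3 c₆) :
    padicValInt 3 Δ + 3 = 3 * padicValInt 3 c₄ ∧
      (Δ / 3 ^ padicValInt 3 Δ % 9 = 1 ∨ Δ / 3 ^ padicValInt 3 Δ % 9 = 8) := by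
  set a := padicValInt 3 c₄ with ha
  obtain ⟨c, hc⟩ : (3 : ℤ) ^ a ∣ c₄ := by exact_mod_cast padicValInt_dvd (p := 3) c₄
  have hc3 : ¬ (3 : ℤ) ∣ c := by
    rintro ⟨e, rfl⟩
    have h' : (3 : ℤ) ^ (a + 1) ∣ c₄ := ⟨e, by rw [hc]; ring⟩
    rcases (padicValInt_dvd_iff (a + 1) c₄).mp (by exact_mod_cast h') with h | h
    · exact h4 h
    · omega
  -- `3^(3a+2) ∣ c₆²`
  obtain ⟨m, hm⟩ : (3 : ℤ) ^ (3 * a + 2) ∣ c₆ ^ 2 := by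
    rcases hcrit with h0 | hle
    · exact ⟨0, by rw [h0]; ring⟩
    · have h6 : (3 : ℤ) ^ padicValInt 3 c₆ ∣ c₆ := by exact_mod_cast padicValInt_dvd (p := 3) c₆
      have h6' : (3 : ℤ) ^ (2 * padicValInt 3 c₆) ∣ c₆ ^ 2 := by
        rw [mul_comm, pow_mul]; exact pow_dvd_pow_of_dvd h6 2
      exact (pow_dvd_pow (3 : ℤ) hle).trans h6'
  -- `a ≥ 1`
  have key0 : 1728 * Δ = (3 : ℤ) ^ (3 * a) * (c ^ 3 - 9 * m) := by
    rw [hrel, hc, hm]; ring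
  have ha1 : 1 ≤ a := by
    by_contra h0
    have ha0 : a = 0 := by omega
    rw [ha0, mul_zero, pow_zero, one_mul] at key0
    apply hc3
    have h3 : (3 : ℤ) ∣ c ^ 3 := ⟨576 * Δ + 3 * m, by linear_combination -1 * key0⟩
    exact Int.Prime.dvd_pow' (by norm_num) h3
  obtain ⟨a₀, ha₀⟩ : ∃ a₀, a = a₀ + 1 := ⟨a - 1, by omega⟩
  rw [ha₀] at key0
  have key : 64 * Δ = (3 : ℤ) ^ (3 * a₀) * (c ^ 3 - 9 * m) := by
    have h27 : (27 : ℤ) ≠ 0 := by norm_num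
    apply mul_left_cancel₀ h27
    linear_combination key0
  -- `3^(3a₀) ∣ Δ`
  have hcop : IsCoprime ((3 : ℤ) ^ (3 * a₀)) 64 := by
    apply IsCoprime.pow_left
    rw [Int.isCoprime_iff_gcd_eq_one]; decide
  obtain ⟨D, hD⟩ : (3 : ℤ) ^ (3 * a₀) ∣ Δ := hcop.dvd_of_dvd_mul_left ⟨c ^ 3 - 9 * m, by rw [← key]⟩
  have h30 : (3 : ℤ) ^ (3 * a₀) ≠ 0 := pow_ne_zero _ (by norm_num)
  have hD64 : 64 * D = c ^ 3 - 9 * m := by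
    apply mul_left_cancel₀ h30
    linear_combination (hD ▸ key : 64 * ((3 : ℤ) ^ (3 * a₀) * D) = 3 ^ (3 * a₀) * (c ^ 3 - 9 * m))
  have hD3 : ¬ (3 : ℤ) ∣ D := by
    rintro ⟨e, rfl⟩
    apply hc3
    have h3 : (3 : ℤ) ∣ c ^ 3 := ⟨64 * e + 3 * m, by linear_combination -1 * hD64⟩
    exact Int.Prime.dvd_pow' (by norm_num) h3
  -- `v₃(Δ) = 3a₀`
  have hv : padicValInt 3 Δ = 3 * a₀ := by
    refine padicValInt_three_eq_of_dvd_of_not_dvd ⟨D, hD⟩ ?_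
    rintro ⟨e, he⟩
    apply hD3
    refine ⟨e, mul_left_cancel₀ h30 ?_⟩
    rw [← hD, he]; ring
  refine ⟨by omega, ?_⟩
  rw [hv, hD, Int.mul_ediv_cancel_left _ h30]
  -- `D ≡ c³ (mod 9)`, `c` a unit mod `3`
  have hcong : ((D : ℤ) : ZMod 9) = ((c : ℤ) : ZMod 9) ^ 3 := by
    have h := congrArg (fun z : ℤ ↦ (z : ZMod 9)) hD64
    simp only [Int.cast_mul, Int.cast_sub, Int.cast_pow, Int.cast_ofNat] at h
    have h64 : (64 : ZMod 9) = 1 := by decide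
    have h9 : (9 : ZMod 9) = 0 := by decide
    rw [h64, one_mul, h9, zero_mul, sub_zero] at h
    exact h
  have hcu : ((c : ℤ) : ZMod 9) ^ 3 ≠ 0 := by
    intro h0
    apply hc3
    have h27 : ((c ^ 3 : ℤ) : ZMod 9) = 0 := by push_cast; exact h0
    rw [ZMod.intCast_zmod_eq_zero_iff_dvd] at h27
    have h3 : (3 : ℤ) ∣ c ^ 3 := (show (3 : ℤ) ∣ 9 by norm_num).trans (by exact_mod_cast h27)
    exact Int.Prime.dvd_pow' (by norm_num) h3
  set r : ℤ := D % 9 with hr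
  have hr0 : 0 ≤ r := Int.emod_nonneg D (by norm_num)
  have hr9 : r < 9 := Int.emod_lt_of_pos D (by norm_num)
  have hrc : ((r : ℤ) : ZMod 9) = ((c : ℤ) : ZMod 9) ^ 3 := by
    have hru : ((r : ℤ) : ZMod 9) = (D : ZMod 9) := by rw [hr]; exact_mod_cast ZMod.intCast_mod D 9
    rw [hru]; exact hcong
  rcases zmod_nine_cube_of_unit _ hcu with h | h <;> rw [h] at hrc <;>
    interval_cases r <;> first | (left; rfl) | (right; rfl) | (exfalso; revert hrc; decide)

end Integers

/-! ## §2 Curves over `ℚ` -/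

section Curves

variable (W : WeierstrassCurve ℚ) [W.IsElliptic] [W.IsGloballyMinimal]

/-- **IRR at `3` ⟹ the cube class**: `W[3]|G_{ℚ₃}` irreducible (`LocIrr W 3`) ⟹ `3 ∣ v₃(Δ_min)` and
`Δ_min/3^{v₃Δ_min} ≡ ±1 (mod 9)` (E89's criterion `3v₃c₄ + 2 ≤ 2v₃c₆` read on the integer model).
[cite: Cremona1997, §3.8 (l = 3)] [cite: Serre1972, §5.3] -/
theorem three_dvd_and_mod_nine_of_locIrr (hL : LocIrr W 3) :
    3 ∣ padicValInt 3 W.minimalDiscriminantInt ∧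
      (W.minimalDiscriminantInt / 3 ^ padicValInt 3 W.minimalDiscriminantInt % 9 = 1 ∨
        W.minimalDiscriminantInt / 3 ^ padicValInt 3 W.minimalDiscriminantInt % 9 = 8) := by
  obtain ⟨h4, hcrit⟩ := (locIrr_three_iff_locIrrCriterionThree W).mp hL
  set c₄ : ℤ := (integralModelInt W).c₄ with hc₄
  set c₆ : ℤ := (integralModelInt W).c₆ with hc₆
  have hc4q : W.c₄ = (c₄ : ℚ) := by rw [hc₄, cast_integralModelInt_c₄]
  have hc6q : W.c₆ = (c₆ : ℚ) := by rw [hc₆, cast_integralModelInt_c₆]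
  have h4' : c₄ ≠ 0 := fun h0 ↦ h4 (by rw [hc4q, h0, Int.cast_zero])
  have hrel : 1728 * W.minimalDiscriminantInt = c₄ ^ 3 - c₆ ^ 2 := (integralModelInt W).c_relation
  have hcrit' : c₆ = 0 ∨ 3 * padicValInt 3 c₄ + 2 ≤ 2 * padicValInt 3 c₆ := by
    rcases hcrit with h0 | hle
    · left; exact_mod_cast (show (c₆ : ℚ) = 0 by rw [← hc6q, h0])
    · right
      rw [hc4q, hc6q, padicValRat.of_int, padicValRat.of_int] at hle
      omega
  obtain ⟨hv, h9⟩ := cube_class_of_c_relation h4' hrel hcrit'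
  exact ⟨⟨padicValInt 3 c₄ - 1, by omega⟩, h9⟩

/-- The same from the V10 predicate `ShapeIrrThree W` (no `ℚ₃`-root of `Ψ₃`). [cite: Serre1972, §5.3] -/
theorem three_dvd_and_mod_nine_of_shapeIrrThree (h : ShapeIrrThree W) :
    3 ∣ padicValInt 3 W.minimalDiscriminantInt ∧
      (W.minimalDiscriminantInt / 3 ^ padicValInt 3 W.minimalDiscriminantInt % 9 = 1 ∨
        W.minimalDiscriminantInt / 3 ^ padicValInt 3 W.minimalDiscriminantInt % 9 = 8) :=
  three_dvd_and_mod_nine_of_locIrr W ((locIrr_three_iff_shapeIrrThree W).mpr h)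

/-- **No unique stable line ⟹ the cube class** (IRR: E89; SPLIT: the resolvent identity
`Δ = −(2b₄ + b₂(r+r') + 3(r+r')²)³`). [cite: Serre1972, §5.3] [cite: Cremona1997, §3.8] -/
theorem three_dvd_and_mod_nine_of_not_existsUnique (h : ¬ ∃ x₀, IsUniqueStableLineThree W x₀) :
    3 ∣ padicValInt 3 W.minimalDiscriminantInt ∧
      (W.minimalDiscriminantInt / 3 ^ padicValInt 3 W.minimalDiscriminantInt % 9 = 1 ∨
        W.minimalDiscriminantInt / 3 ^ padicValInt 3 W.minimalDiscriminantInt % 9 = 8) := by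
  by_cases hirr : ShapeIrrThree W
  · exact three_dvd_and_mod_nine_of_shapeIrrThree W hirr
  · obtain ⟨r, hr⟩ : ∃ r : ℚ_[3], ((W.baseChange ℚ_[3]).Ψ₃).IsRoot r := by
      unfold ShapeIrrThree at hirr; push Not at hirr; exact hirr
    have hsplit : ShapeSplitThree W := by
      by_contra hs
      apply h
      refine ⟨r, hr, fun s hs' ↦ ?_⟩
      by_contra hne
      exact hs ⟨s, r, hne, hs', hr⟩
    exact three_dvd_and_mod_nine_of_shapeSplitThree W hsplit

/-- **THE CUBE-CLASS CRITERION: `Δ_min` not a `3`-adic cube ⟹ exactly one stable line at `3`** — for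
every elliptic globally minimal `W/ℚ` with `3 ∤ v₃(Δ_min)` or `Δ_min/3^{v₃Δ_min} ≢ ±1 (mod 9)`, `Ψ₃`
has exactly one root in `ℚ₃` (`W[3]|G_{ℚ₃}` reducible, non-split, one stable line).
[cite: Serre1972, §5.3] [cite: Cremona1997, §3.8 (l = 3)] -/
theorem existsUnique_stableLine_of_not_cubeClass
    (h : ¬ 3 ∣ padicValInt 3 W.minimalDiscriminantInt ∨
      (W.minimalDiscriminantInt / 3 ^ padicValInt 3 W.minimalDiscriminantInt % 9 ≠ 1 ∧
        W.minimalDiscriminantInt / 3 ^ padicValInt 3 W.minimalDiscriminantInt % 9 ≠ 8)) :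
    ∃ x₀, IsUniqueStableLineThree W x₀ := by
  by_contra hne
  obtain ⟨h3, h9⟩ := three_dvd_and_mod_nine_of_not_existsUnique W hne
  rcases h with h | ⟨h1, h8⟩
  · exact h h3
  · exact h9.elim h1 h8

/-- The census column: `numStableLinesAtThree W = 1` whenever `Δ_min` is not a `3`-adic cube. [folklore] -/
theorem numStableLinesAtThree_eq_one_of_not_cubeClass
    (h : ¬ 3 ∣ padicValInt 3 W.minimalDiscriminantInt ∨
      (W.minimalDiscriminantInt / 3 ^ padicValInt 3 W.minimalDiscriminantInt % 9 ≠ 1 ∧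
        W.minimalDiscriminantInt / 3 ^ padicValInt 3 W.minimalDiscriminantInt % 9 ≠ 8)) :
    numStableLinesAtThree W = 1 :=
  (numStableLinesAtThree_eq_one_iff W).mpr (existsUnique_stableLine_of_not_cubeClass W h)

/-- In particular `3 ∤ v₃(Δ_min)` alone (every multiplicative `I_n` with `3 ∤ n`, every additive row with
`v₃Δ_min ∉ 3ℤ`, every good curve with `3 ∤ v₃Δ` — i.e. all of them with `Δ` a non-cube unit aside) gives
one stable line. [cite: Serre1972, §5.3] -/
theorem existsUnique_stableLine_of_not_three_dvd (h : ¬ 3 ∣ padicValInt 3 W.minimalDiscriminantInt) :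
    ∃ x₀, IsUniqueStableLineThree W x₀ :=
  existsUnique_stableLine_of_not_cubeClass W (Or.inl h)

end Curves

end Summit.BirchSwinnertonDyer.BirchSwinnertonDyer.Theorems.PSLocalThreeTorsion

end
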